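import Literature.Geometry.Manifold.CylinderSlice
import Literature.Geometry.Manifold.OpenSubmanifoldMFDeriv
import Literature.Geometry.Riemannian.SphericalCylinderEntropy
import Literature.Geometry.Riemannian.RoundSphere
import Literature.Geometry.Lorentzian.LeviCivitaProofs
import Literature.Geometry.Lorentzian.IsometryProofs
import Literature.Topology.FourManifolds.ImmersionCriterion
import Mathlib.Analysis.InnerProductSpace.Calculus
import Mathlib.Analysis.SpecialFunctions.Log.Deriv
import HarnessLib

/-!
# A presentation of the round cylinder `N = S⁴ × ℝ ⊂ ℝ⁶` as an abstract Riemannian `5`-manifold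

Line `proxy-models-below-bubble-sheet` of crux `CylinderEntropy.CylinderRungTwo` (stmt-SmoothPoincare4-7631):
definition request D1 of its line card ("a presentation EXISTS and is cheap: `ℝ⁵ ∖ {0}` re-charted as an
open subset, `emb y = (y/‖y‖, log ‖y‖)`, induced metric") — the object every analytic stub of the line
quantifies over, and the first obligation inside the `∃` of its port stub `stub_densityDropPort`.

## What

`presentationExists`: there is a `C^∞` `5`-manifold `Ncar` on `ℝ⁵` (here: the open subset
`ℝ⁵ ∖ {0}` of `EuclideanSpace ℝ (Fin 5)` with Mathlib's open-submanifold structure), a tree metric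
`gN : PseudoRiemannianMetric (𝓡 5) ∞ …` on it carrying its Levi-Civita connection, and a map
`emb : Ncar → ℝ⁶` such that `emb` is a `C^∞` embedding (`Manifold.IsSmoothEmbedding (𝓡 5) (𝓡 6) ∞`),
`range emb = {z | ∑_{i<5} zᵢ² = 1}` exactly, and `gN(v, v) = ‖d emb (v)‖²` — i.e. the conjunction
`IsCylinderPresentation gN emb` of the skeleton, unfolded (so that this file needs no line-local
vocabulary).

## Proof (fact-free)

`emb y = padL (‖y‖⁻¹ • y) + log ‖y‖ • e₅` (`padL`, `axis` of `CylinderSlice.lean`). It is `C^∞` on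
`{y ≠ 0}` (`contDiffAt_norm`, `Real.contDiffAt_log`), and `retr z = exp z₅ • truncL z` is a `C^∞` map
`ℝ⁶ → ℝ⁵` with `retr ∘ emb = Subtype.val`; hence `d emb` is injective (chain rule: `d retr ∘ d emb = id`),
so `emb` is an immersion by the tree's rank criterion
(`Literature.Topology.FourManifolds.isImmersion_of_injective_mfderiv`), and a topological embedding
because `retr ∘ emb` is (`Topology.IsEmbedding.of_comp`). The range is the cylinder (`z ↦ exp z₅ • z'` is
the inverse). The metric is the tree's `inducedMetric` of the Euclidean metric of `ℝ⁶` along `emb`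
(as `RoundSphere.roundMetric`), whose value on `(v, v)` is `⟪d emb v, d emb v⟫ = ‖d emb v‖²`, and it has
its Levi-Civita connection by the tree theorem `PseudoRiemannianMetric.hasLeviCivita`.

## References

* B. O'Neill, *Semi-Riemannian Geometry* (1983), Ch. 3, Def. 3.4, p. 57 (Riemannian submanifolds,
  induced metric), Thm. 3.11 (Levi-Civita). [ONeill1983]
* J. M. Lee, *Introduction to Smooth Manifolds*, 2nd ed. (2013), Prop. 4.1, Prop. 5.2. [LeeSmoothManifolds2013]
-/

-- the prescribed namespace `Summit.SmoothPoincare4.SmoothPoincare4.…` repeats `SmoothPoincare4`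
set_option linter.dupNamespace false

noncomputable section

open scoped Manifold ContDiff Topology RealInnerProductSpace
open Set Function
open Literature.Geometry.Manifold.CylinderSlice (padL axis padL_apply_castSucc padL_apply_last castSucc_ne_five
  padL_injective)
open Literature.Geometry.Riemannian.SphericalCylinderEntropy (truncL truncL_apply)
open Literature.Geometry.Lorentzian Literature.Geometry.Lorentzian.PseudoRiemannianMetric
open Literature.Geometry.Riemannian (euclideanMetric euclideanMetric_apply)

namespace Summit.SmoothPoincare4.SmoothPoincare4.Theorems.CylinderRungTwo.ProxyModels

local notation "E5" => EuclideanSpace ℝ (Fin 5)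
local notation "E6" => EuclideanSpace ℝ (Fin 6)

/-! ### The carrier `ℝ⁵ ∖ {0}` and the two maps -/

/-- The carrier of the presentation: the open subset `ℝ⁵ ∖ {0}` of `EuclideanSpace ℝ (Fin 5)` (an open
submanifold, charted on `ℝ⁵`). [folklore] -/
def punct : TopologicalSpace.Opens E5 := ⟨{y | y ≠ 0}, isOpen_ne⟩

/-- The raw presentation map `ℝ⁵ → ℝ⁶`, `y ↦ (y/‖y‖, log ‖y‖)`. [folklore] -/
def presRaw (y : E5) : E6 := padL (‖y‖⁻¹ • y) + Real.log ‖y‖ • axis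

/-- The presentation map `emb : ℝ⁵ ∖ {0} → ℝ⁶`, `y ↦ (y/‖y‖, log ‖y‖)`. [folklore] -/
def presEmb (y : punct) : E6 := presRaw y

/-- The retraction `ℝ⁶ → ℝ⁵`, `z ↦ e^{z₅} · z'` (a global `C^∞` left inverse of the presentation map). [folklore] -/
def retr (z : E6) : E5 := Real.exp (z 5) • truncL z

/-- First five coordinates of the presentation map: `yᵢ/‖y‖`. [folklore] -/
theorem presRaw_apply_castSucc (y : E5) (i : Fin 5) : presRaw y (Fin.castSucc i) = ‖y‖⁻¹ * y i := by
  simp [presRaw, axis, castSucc_ne_five i]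

/-- Last coordinate of the presentation map: `log ‖y‖`. [folklore] -/
theorem presRaw_apply_last (y : E5) : presRaw y 5 = Real.log ‖y‖ := by
  simp [presRaw, axis]

/-- `truncL` undoes `padL`: the first five coordinates of `presRaw y` form `‖y‖⁻¹ • y`. [folklore] -/
theorem truncL_presRaw (y : E5) : truncL (presRaw y) = ‖y‖⁻¹ • y := by
  ext i
  simp [truncL_apply, presRaw_apply_castSucc]

/-- `retr` is a left inverse of the presentation map on `ℝ⁵ ∖ {0}`. [folklore] -/
theorem retr_presRaw {y : E5} (hy : y ≠ 0) : retr (presRaw y) = y := by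
  have hn : ‖y‖ ≠ 0 := norm_ne_zero_iff.2 hy
  simp only [retr, presRaw_apply_last, truncL_presRaw, Real.exp_log (norm_pos_iff.2 hy), smul_smul,
    mul_inv_cancel₀ hn, one_smul]

/-- `retr ∘ presEmb = Subtype.val`. [folklore] -/
theorem retr_comp_presEmb : retr ∘ presEmb = (Subtype.val : punct → E5) :=
  funext fun y => retr_presRaw y.2

/-- `retr` is `C^∞`. [folklore] -/
theorem contDiff_retr : ContDiff ℝ ∞ retr :=
  (Real.contDiff_exp.comp (EuclideanSpace.proj (5 : Fin 6)).contDiff).smul truncL.contDiff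

/-- The presentation map is `C^∞` at every `y ≠ 0`. [folklore] -/
theorem contDiffAt_presRaw {n : ℕ∞ω} {y : E5} (hy : y ≠ 0) : ContDiffAt ℝ n presRaw y := by
  have hnorm : ContDiffAt ℝ n (fun y : E5 => ‖y‖) y := contDiffAt_norm ℝ hy
  have hn : ‖y‖ ≠ 0 := norm_ne_zero_iff.2 hy
  have h1 : ContDiffAt ℝ n (fun y : E5 => ‖y‖⁻¹ • y) y := (hnorm.inv hn).smul contDiffAt_id
  have h2 : ContDiffAt ℝ n (fun y : E5 => Real.log ‖y‖) y := (Real.contDiffAt_log.2 hn).comp y hnorm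
  exact (padL.contDiff.contDiffAt.comp y h1).add (h2.smul contDiffAt_const)

/-- The presentation map is `C^∞` on `ℝ⁵ ∖ {0}`. [folklore] -/
theorem contMDiffOn_presRaw {n : ℕ∞ω} : ContMDiffOn 𝓘(ℝ, E5) 𝓘(ℝ, E6) n presRaw {y | y ≠ 0} := by
  rw [contMDiffOn_iff_contDiffOn]
  exact fun y hy => (contDiffAt_presRaw hy).contDiffWithinAt

/-- `presEmb` is `C^∞` (any order). [folklore] -/
theorem contMDiff_presEmb {n : ℕ∞ω} : ContMDiff (𝓡 5) (𝓡 6) n presEmb :=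
  contMDiffOn_presRaw.comp_contMDiff contMDiff_subtype_val fun y => y.2

/-- The differential of `presEmb` is injective: `d retr ∘ d presEmb = d (Subtype.val) = id`. [folklore] -/
theorem injective_mfderiv_presEmb (y : punct) : Injective (mfderiv (𝓡 5) (𝓡 6) presEmb y) := by
  have hval : mfderiv (𝓡 5) (𝓡 5) (Subtype.val : punct → E5) y = ContinuousLinearMap.id ℝ E5 :=
    Literature.Geometry.Manifold.OpenSubmanifold.mfderiv_subtype_val y
  have hpres : MDifferentiableAt (𝓡 5) (𝓡 6) presEmb y :=
    (contMDiff_presEmb (n := ∞) y).mdifferentiableAt (by simp)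
  have hretr : MDifferentiableAt (𝓡 6) (𝓡 5) retr (presEmb y) :=
    (contDiff_retr.contMDiff (presEmb y)).mdifferentiableAt (by simp)
  have hcomp : mfderiv (𝓡 5) (𝓡 5) (retr ∘ presEmb) y =
      (mfderiv (𝓡 6) (𝓡 5) retr (presEmb y)).comp (mfderiv (𝓡 5) (𝓡 6) presEmb y) :=
    mfderiv_comp y hretr hpres
  rw [retr_comp_presEmb, hval] at hcomp
  have key : ∀ x : TangentSpace (𝓡 5) y,
      (mfderiv (𝓡 6) (𝓡 5) retr (presEmb y)) ((mfderiv (𝓡 5) (𝓡 6) presEmb y) x) = x := fun x => by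
    exact (DFunLike.congr_fun hcomp x).symm
  exact Function.LeftInverse.injective key

/-- `presEmb` is a `C^∞` embedding in Mathlib's chart sense: an immersion by the rank criterion, a
topological embedding because `retr ∘ presEmb = Subtype.val` is one. [folklore] -/
theorem isSmoothEmbedding_presEmb : Manifold.IsSmoothEmbedding (𝓡 5) (𝓡 6) ∞ presEmb := by
  refine ⟨Literature.Topology.FourManifolds.isImmersion_of_injective_mfderiv contMDiff_presEmb (by norm_num)
    injective_mfderiv_presEmb, ?_⟩
  refine Topology.IsEmbedding.of_comp (contMDiff_presEmb (n := ∞)).continuous contDiff_retr.continuous ?_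
  rw [retr_comp_presEmb]
  exact Topology.IsEmbedding.subtypeVal

/-- The presentation map lands in the cylinder: `∑_{i<5} (presRaw y)ᵢ² = 1` for `y ≠ 0`. [folklore] -/
theorem sum_sq_presRaw {y : E5} (hy : y ≠ 0) : ∑ i : Fin 5, presRaw y (Fin.castSucc i) ^ 2 = 1 := by
  have hn : ‖y‖ ≠ 0 := norm_ne_zero_iff.2 hy
  have h2 := EuclideanSpace.norm_sq_eq y
  simp only [Real.norm_eq_abs, sq_abs] at h2
  simp only [presRaw_apply_castSucc, mul_pow, ← Finset.mul_sum, ← h2]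
  field_simp

/-- **The range of the presentation map is exactly the cylinder** `{z | ∑_{i<5} zᵢ² = 1}`
(`z ↦ e^{z₅} z'` is the inverse). [folklore] -/
theorem range_presEmb : Set.range presEmb = {z : E6 | ∑ i : Fin 5, z (Fin.castSucc i) ^ 2 = 1} := by
  ext z
  constructor
  · rintro ⟨y, rfl⟩
    exact sum_sq_presRaw y.2
  · intro hz
    have hz' : ‖truncL z‖ = 1 := by
      rw [EuclideanSpace.norm_eq, Real.sqrt_eq_one]
      simpa [truncL_apply, Real.norm_eq_abs, sq_abs] using hz
    have hne : retr z ≠ 0 := by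
      intro h
      have : ‖retr z‖ = 0 := by rw [h, norm_zero]
      rw [retr, norm_smul, hz', mul_one, Real.norm_eq_abs, abs_of_pos (Real.exp_pos _)] at this
      exact (Real.exp_pos _).ne' this
    refine ⟨⟨retr z, hne⟩, ?_⟩
    have hnr : ‖retr z‖ = Real.exp (z 5) := by
      rw [retr, norm_smul, hz', mul_one, Real.norm_eq_abs, abs_of_pos (Real.exp_pos _)]
    show presRaw (retr z) = z
    ext j
    induction j using Fin.lastCases with
    | last =>
      rw [show (Fin.last 5 : Fin 6) = 5 from rfl, presRaw_apply_last, hnr, Real.log_exp]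
    | cast i =>
      rw [presRaw_apply_castSucc, hnr]
      simp only [retr, PiLp.smul_apply, smul_eq_mul, truncL_apply]
      rw [inv_mul_cancel_left₀ (Real.exp_pos _).ne']

/-! ### The induced metric -/

/-- `presEmb` is a spacelike immersion for the Euclidean metric of `ℝ⁶` (injective differential). [folklore] -/
theorem isSpacelikeImmersion_presEmb :
    (euclideanMetric E6).IsSpacelikeImmersion (𝓡 5) presEmb := by
  refine ⟨contMDiff_presEmb, fun y v hv => ?_⟩
  rw [inducedBilin_apply, euclideanMetric_apply]
  have hne : mfderiv (𝓡 5) (𝓡 6) presEmb y v ≠ 0 := fun h =>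
    hv (injective_mfderiv_presEmb y (by rw [h, map_zero]))
  exact (real_inner_self_pos (F := E6)).mpr hne

/-- The metric of the presentation: the Euclidean metric of `ℝ⁶` induced along `presEmb`
(tree `PseudoRiemannianMetric.inducedMetric`, as `RoundSphere.roundMetric`). [folklore] -/
def presMetric : PseudoRiemannianMetric (𝓡 5) ∞ (EuclideanSpace ℝ (Fin 5)) (TangentSpace (𝓡 5) : punct → Type _) :=
  (euclideanMetric E6).inducedMetric presEmb contMDiff_pullbackBilin_holds isSpacelikeImmersion_presEmb

/-- `presMetric (v, w) = ⟪d presEmb v, d presEmb w⟫`. [folklore] -/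
theorem presMetric_apply (y : punct) (v w : TangentSpace (𝓡 5) y) :
    presMetric.val y v w =
      @inner ℝ E6 _ (mfderiv (𝓡 5) (𝓡 6) presEmb y v) (mfderiv (𝓡 5) (𝓡 6) presEmb y w) :=
  euclideanMetric_apply (V := E6) (presEmb y) _ _

/-- `presMetric (v, v) = ‖d presEmb (v)‖²`. [folklore] -/
theorem presMetric_apply_self (y : punct) (v : TangentSpace (𝓡 5) y) :
    presMetric.val y v v = ‖(@id E6 (mfderiv (𝓡 5) (𝓡 6) presEmb y v))‖ ^ 2 := by
  rw [presMetric_apply, real_inner_self_eq_norm_sq (F := E6)]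
  rfl

/-- The presentation metric carries its Levi-Civita connection (tree theorem
`PseudoRiemannianMetric.hasLeviCivita`). [folklore] -/
theorem hasLeviCivita_presMetric : presMetric.HasLeviCivita := presMetric.hasLeviCivita

/-- **A presentation of `N = S⁴ × ℝ` exists** (the skeleton's `IsCylinderPresentation gN emb`, unfolded,
with `∃` over the carrier, its instances, the metric and its Levi-Civita instance): `ℝ⁵ ∖ {0}` with the
metric induced along `y ↦ (y/‖y‖, log ‖y‖)`. [folklore] -/
theorem presentationExists :
    ∃ (Ncar : Type) (_ : TopologicalSpace Ncar) (_ : ChartedSpace (EuclideanSpace ℝ (Fin 5)) Ncar)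
      (_ : IsManifold (𝓡 5) ∞ Ncar)
      (gN : PseudoRiemannianMetric (𝓡 5) ∞ (EuclideanSpace ℝ (Fin 5)) (TangentSpace (𝓡 5) : Ncar → Type _))
      (_ : gN.HasLeviCivita) (emb : Ncar → EuclideanSpace ℝ (Fin 6)),
      Manifold.IsSmoothEmbedding (𝓡 5) (𝓡 6) ∞ emb ∧
        Set.range emb = {z : EuclideanSpace ℝ (Fin 6) | ∑ i : Fin 5, z (Fin.castSucc i) ^ 2 = 1} ∧
        ∀ (x : Ncar) (v : TangentSpace (𝓡 5) x),
          gN.val x v v = ‖(@id (EuclideanSpace ℝ (Fin 6)) (mfderiv (𝓡 5) (𝓡 6) emb x v))‖ ^ 2 :=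
  ⟨punct, inferInstance, inferInstance, inferInstance, presMetric, hasLeviCivita_presMetric, presEmb,
    isSmoothEmbedding_presEmb, range_presEmb, presMetric_apply_self⟩

/-- **Registered stub `stub_presentationExists`** of the skeleton `Cruxes/CylinderRungTwo/Lines/proxy-models-below-bubble-sheet.lean`
(generation 3, second lead), verbatim signature: a presentation `(Ncar, gN, emb)` of `N = S⁴ × ℝ` exists. [folklore] -/
theorem stub_presentationExists :
    ∃ (Ncar : Type) (_ : TopologicalSpace Ncar) (_ : ChartedSpace (EuclideanSpace ℝ (Fin 5)) Ncar)
      (_ : IsManifold (𝓡 5) ∞ Ncar)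
      (gN : PseudoRiemannianMetric (𝓡 5) ∞ (EuclideanSpace ℝ (Fin 5)) (TangentSpace (𝓡 5) : Ncar → Type _))
      (_ : gN.HasLeviCivita) (emb : Ncar → EuclideanSpace ℝ (Fin 6)),
      Manifold.IsSmoothEmbedding (𝓡 5) (𝓡 6) ∞ emb ∧
        Set.range emb = {z : EuclideanSpace ℝ (Fin 6) | ∑ i : Fin 5, z (Fin.castSucc i) ^ 2 = 1} ∧
        ∀ (x : Ncar) (v : TangentSpace (𝓡 5) x),
          gN.val x v v = ‖(@id (EuclideanSpace ℝ (Fin 6)) (mfderiv (𝓡 5) (𝓡 6) emb x v))‖ ^ 2 :=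
  presentationExists

end Summit.SmoothPoincare4.SmoothPoincare4.Theorems.CylinderRungTwo.ProxyModels

end
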